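import Summits.ValiantsHypothesis.ValiantsHypothesis.Theorems.LacunarySymmetroidMatrixDescartesCensusDoorA34SheetDefiniteNappe
import Summits.ValiantsHypothesis.ValiantsHypothesis.Theorems.LacunarySymmetroidMatrixDescartesCensusDoorA34NullNullSheetDefiniteLetter

/-!
# `MatrixDescartes` census — DOOR A at `(3,4)`: END-CELL PINNING on the NULL-NULL sheet — with one singular end letter semidefinite, the signs of the two slots
# `{0,0,3}`, `{0,3,3}` decide the cell of the OTHER singular end letter; the doubly-semidefinite cells of `stub_nullNullCeiling` get orientation-free closures

HONEST FRAMING.  Object-search cell `pub-symmetroid`, engine seat `val-sym-eng-2` (g5); helper rows beside the registered strata line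
`Cruxes/DoorA34/Lines/strata.lean` on stmt-ValiantsHypothesis-19980 (`DoorA34 = PosRootLawAt 3 4 18`: OPEN, typed, never asserted here); this file concerns the third stub
`stub_nullNullCeiling` (`det S₀ = det S₃ = 0 ⇒ ≤ 16`).  The isotropic-cone machinery of …SheetIsotropicCone / …SheetHiddenDefinite applies at EACH singular end.  New here:
the end letters are themselves singular (rank two on a seventeen), and their cells (semidefinite of either sign / indefinite) are PINNED by slot signs:

* `posSemidef_of_adjugate_witness_of_det_nonneg` (the PSD criterion of …SheetHiddenDefinite with `det S ≥ 0`), `trace_mul_nonneg_of_posSemidef_posSemidef`;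
* **`endCell_of_sheet_signs`** — `P ⪰ 0` with kernel vector `k`, `S` symmetric with `det S ≥ 0`... used at `det S = 0`: `q_P(S) > 0 ∧ kᵀSk > 0 ⇒ S ⪰ 0`;
  `q_P(S) > 0 ∧ kᵀSk < 0 ⇒ S ⪯ 0`; `q_P(S) < 0 ⇒ S` neither (`not_semidef_of_trace_adjugate_mul_neg`);
* **`endCell_of_nullNull_seventeen`** — on a null-null seventeen (sorted support, symmetric letters) with `S₃ ⪰ 0`: `c_{003} > 0 ∧ c_{033} > 0 ⇒ S₀ ⪰ 0`,
  `c_{003} > 0 ∧ c_{033} < 0 ⇒ S₀ ⪯ 0`, `c_{003} < 0 ⇒ S₀` indefinite (`c_{003} = tr(adj S₀·S₃)`, `c_{033} = tr(adj S₃·S₀)`); the mirror statements with the ends exchanged;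
* **orientation-free closures** `card_posRoots_le_16_of_nullNull_psd_psd` (`S₀ ⪰ 0`, `S₃ ⪰ 0`, `ρ(2d₀+d₃) ≢ ρ(d₀+2d₃)` ⇒ `≤ 16`), `…_psd_nsd` (`S₀ ⪰ 0`, `S₃ ⪯ 0`,
  `ρ(2d₀+d₃) ≡ ρ(d₀+2d₃)` ⇒ `≤ 16`) and, by `S ↦ −S`, `…_nsd_nsd`, `…_nsd_psd`; oriented closures `card_posRoots_le_16_of_nullNull_endTest` (semidefinite `S₃`, any `S₀`,
  orientation read on the bottom slot `c_{001}`).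

LOCATED (seat atlas of the null-null sheet, report HOME/DOOR-A34-ENG2G5-REPORT.md §4): tallies of the 9 cells × 80 chambers.  Nothing here bounds anything else; `DoorA34` and
the three stubs stay OPEN; registers unchanged; nothing on `MatrixDescartes` (stmt-ValiantsHypothesis-18050) or `VP ≠ VNP` — VP≠VNP not moved.  [folklore] Elementary.
-/

-- `Summit.ValiantsHypothesis.ValiantsHypothesis.…` repeats a component by the D-0017 layout
-- (single-conjunct summit), which the `dupNamespace` linter flags; the name is mandated.
set_option linter.dupNamespace false

namespace Summit.ValiantsHypothesis.ValiantsHypothesis.Theorems.LacunarySymmetroidMatrixDescartes.Census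

open Polynomial Finset Matrix
open scoped BigOperators Polynomial Matrix

/-! ## 1. Semidefiniteness of a (possibly singular) letter from an adjugate witness -/

/-- The PSD criterion of …SheetHiddenDefinite with `det S ≥ 0` (so singular letters are allowed): `v ≠ 0`, `vᵀadj(S)v > 0`, `k ⊥ v`, `kᵀSk > 0`, `det S ≥ 0`
⇒ `S ⪰ 0`. [folklore] -/
theorem posSemidef_of_adjugate_witness_of_det_nonneg (S : Matrix (Fin 3) (Fin 3) ℝ) (hS : S.IsSymm) {v k : Fin 3 → ℝ} (hv : v ≠ 0)
    (hkv : k ⬝ᵥ v = 0) (hadj : 0 < v ⬝ᵥ S.adjugate *ᵥ v) (hT : 0 < k ⬝ᵥ S *ᵥ k) (hdet : 0 ≤ S.det) : S.PosSemidef := by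
  refine Matrix.PosSemidef.of_dotProduct_mulVec_nonneg (isHermitian_iff_isSymm.mpr hS) fun x => ?_
  simp only [star_trivial]
  set z : Fin 3 → ℝ := S.adjugate *ᵥ v with hz
  have hzv : z ⬝ᵥ v = v ⬝ᵥ S.adjugate *ᵥ v := by rw [hz, dotProduct_comm]
  have hSz : S *ᵥ z = S.det • v := mulVec_adjugate_mulVec S v
  set w : Fin 3 → ℝ := (z ⬝ᵥ v) • x - (x ⬝ᵥ v) • z with hw
  have hwv : w ⬝ᵥ v = 0 := by
    rw [hw, sub_dotProduct, smul_dotProduct, smul_dotProduct, smul_eq_mul, smul_eq_mul]; ring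
  have hw0 : 0 ≤ w ⬝ᵥ S *ᵥ w := dotProduct_mulVec_nonneg_of_orthogonal S hS hv hkv hwv hadj.le hT
  have hwz : w ⬝ᵥ S *ᵥ z = 0 := by rw [hSz, dotProduct_smul, hwv, smul_zero]
  have hzz : z ⬝ᵥ S *ᵥ z = S.det * (z ⬝ᵥ v) := by rw [hSz, dotProduct_smul, smul_eq_mul]
  have hx : (z ⬝ᵥ v) • x = w + (x ⬝ᵥ v) • z := by rw [hw]; abel
  have key : (z ⬝ᵥ v) ^ 2 * (x ⬝ᵥ S *ᵥ x) = w ⬝ᵥ S *ᵥ w + (x ⬝ᵥ v) ^ 2 * (S.det * (z ⬝ᵥ v)) := by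
    have e1 : (z ⬝ᵥ v) ^ 2 * (x ⬝ᵥ S *ᵥ x) = ((z ⬝ᵥ v) • x) ⬝ᵥ S *ᵥ ((z ⬝ᵥ v) • x) := (dotProduct_mulVec_smul_self S _ x).symm
    rw [e1, hx, Matrix.mulVec_add, Matrix.mulVec_smul, add_dotProduct, dotProduct_add, dotProduct_add, smul_dotProduct, smul_dotProduct,
      dotProduct_smul, dotProduct_smul, hwz, dotProduct_mulVec_comm_of_isSymm hS z w, hwz, hzz]
    simp only [smul_eq_mul]; ring
  have hzv_pos : 0 < z ⬝ᵥ v := by rw [hzv]; exact hadj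
  have hrhs : 0 ≤ (z ⬝ᵥ v) ^ 2 * (x ⬝ᵥ S *ᵥ x) := by
    rw [key]; exact add_nonneg hw0 (mul_nonneg (sq_nonneg _) (mul_nonneg hdet hzv_pos.le))
  exact nonneg_of_mul_nonneg_right (by rwa [mul_comm] at hrhs) (by positivity)

/-- `tr(A·P) ≥ 0` for `A, P ⪰ 0` (write `P = BᵀB`). [folklore] -/
theorem trace_mul_nonneg_of_posSemidef_posSemidef {A P : Matrix (Fin 3) (Fin 3) ℝ} (hA : A.PosSemidef) (hP : P.PosSemidef) : 0 ≤ (A * P).trace := by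
  open scoped MatrixOrder in
  obtain ⟨B, hB⟩ := CStarAlgebra.nonneg_iff_eq_star_mul_self.mp hP.nonneg
  have hBT : star B = Bᵀ := by
    rw [star_eq_conjTranspose]; exact Matrix.conjTranspose_eq_transpose_of_trivial B
  rw [hBT] at hB
  have htr : (A * P).trace = ∑ i, B i ⬝ᵥ A *ᵥ B i := by
    rw [hB, ← Matrix.mul_assoc, Matrix.trace_mul_comm, ← Matrix.mul_assoc, Matrix.trace]
    refine Finset.sum_congr rfl fun i _ => ?_
    rw [Matrix.diag_apply, mul_mul_transpose_apply_diag]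
  rw [htr]
  exact Finset.sum_nonneg fun i _ => by simpa using hA.dotProduct_mulVec_nonneg (B i)

/-- **END-CELL PINNING (abstract).**  `P ⪰ 0` with kernel vector `k` (`Pk = 0`), `S` symmetric with `det S ≥ 0`-free formulation: `q(S) = tr(adj S·P) > 0` and
`kᵀSk > 0` ⇒ `S ⪰ 0`. [folklore] -/
theorem posSemidef_of_sheet_signs {P S : Matrix (Fin 3) (Fin 3) ℝ} (hP : P.PosSemidef) {k : Fin 3 → ℝ} (hPk : P *ᵥ k = 0)
    (hS : S.IsSymm) (hq : 0 < (S.adjugate * P).trace) (hdet : 0 ≤ S.det) (hT : 0 < k ⬝ᵥ S *ᵥ k) : S.PosSemidef := by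
  open scoped MatrixOrder in
  obtain ⟨B, hB⟩ := CStarAlgebra.nonneg_iff_eq_star_mul_self.mp hP.nonneg
  have hBT : star B = Bᵀ := by
    rw [star_eq_conjTranspose]; exact Matrix.conjTranspose_eq_transpose_of_trivial B
  rw [hBT] at hB
  have hBk : B *ᵥ k = 0 := by
    have h0 : k ⬝ᵥ P *ᵥ k = 0 := by rw [hPk, dotProduct_zero]
    rw [hB, ← Matrix.mulVec_mulVec, Matrix.dotProduct_mulVec, Matrix.vecMul_transpose] at h0
    exact dotProduct_self_eq_zero.mp h0
  have hrow : ∀ i, k ⬝ᵥ B i = 0 := fun i => by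
    have := congrFun hBk i
    rwa [Matrix.mulVec, Pi.zero_apply, dotProduct_comm] at this
  have htr : (S.adjugate * P).trace = ∑ i, B i ⬝ᵥ S.adjugate *ᵥ B i := by
    rw [hB, ← Matrix.mul_assoc, Matrix.trace_mul_comm, ← Matrix.mul_assoc, Matrix.trace]
    refine Finset.sum_congr rfl fun i _ => ?_
    rw [Matrix.diag_apply, mul_mul_transpose_apply_diag]
  obtain ⟨i, -, hi⟩ : ∃ i ∈ (Finset.univ : Finset (Fin 3)), 0 < B i ⬝ᵥ S.adjugate *ᵥ B i := by
    by_contra hno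
    push Not at hno
    have : (S.adjugate * P).trace ≤ 0 := by rw [htr]; exact Finset.sum_nonpos hno
    linarith
  have hvi : B i ≠ 0 := by
    intro h0; rw [h0, zero_dotProduct] at hi; exact lt_irrefl _ hi
  exact posSemidef_of_adjugate_witness_of_det_nonneg S hS hvi (hrow i) hi hT hdet

/-- For `3 × 3` matrices `adj(−S) = adj S` (local copy). [folklore] -/
private theorem adjugate_neg_aux'' (S : Matrix (Fin 3) (Fin 3) ℝ) : (-S).adjugate = S.adjugate := by
  rw [← neg_one_smul ℝ S, Matrix.adjugate_smul]; simp

/-- Mirror: `q(S) > 0`, `det S ≤ 0`, `kᵀSk < 0` ⇒ `−S ⪰ 0`. [folklore] -/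
theorem neg_posSemidef_of_sheet_signs {P S : Matrix (Fin 3) (Fin 3) ℝ} (hP : P.PosSemidef) {k : Fin 3 → ℝ} (hPk : P *ᵥ k = 0)
    (hS : S.IsSymm) (hq : 0 < (S.adjugate * P).trace) (hdet : S.det ≤ 0) (hT : k ⬝ᵥ S *ᵥ k < 0) : (-S).PosSemidef := by
  refine posSemidef_of_sheet_signs hP hPk hS.neg ?_ ?_ ?_
  · rwa [adjugate_neg_aux'']
  · rw [Matrix.det_neg]; simp; linarith
  · rw [Matrix.neg_mulVec, dotProduct_neg]; linarith

/-- **A spacelike letter is in no semidefinite cell**: `P ⪰ 0`, `q(S) = tr(adj S·P) < 0` ⇒ neither `S ⪰ 0` nor `−S ⪰ 0`. [folklore] -/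
theorem not_semidef_of_trace_adjugate_mul_neg {P S : Matrix (Fin 3) (Fin 3) ℝ} (hP : P.PosSemidef) (hq : (S.adjugate * P).trace < 0) :
    ¬ S.PosSemidef ∧ ¬ (-S).PosSemidef := by
  constructor
  · intro hS
    have := trace_mul_nonneg_of_posSemidef_posSemidef (adjugate_posSemidef_of_posSemidef hS) hP
    linarith
  · intro hS
    have := trace_mul_nonneg_of_posSemidef_posSemidef (adjugate_posSemidef_of_posSemidef hS) hP
    rw [adjugate_neg_aux''] at this; linarith

/-! ## 2. On a hypothetical null-null SEVENTEEN: pair signs, and the cell of `S₀` read from two slots -/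

/-- **Pair sign from rank parity (null-null sheet).**  On a null-null seventeen two support exponents with ranks of equal parity carry coefficients of the same sign,
of different parity coefficients of opposite signs. [folklore] -/
theorem coeff_mul_coeff_sign_of_nullNull_seventeen (d : Fin 4 → ℕ) (S : Fin 4 → Matrix (Fin 3) (Fin 3) ℝ) (h0 : (S 0).det = 0) (h3 : (S 3).det = 0)
    (h17 : 17 ≤ ((Matrix.det (∑ l, ((X : ℝ[X]) ^ d l) • (S l).map C)).roots.toFinset.filter (fun t => 0 < t)).card)
    {e e' : ℕ} (he : e ∈ (Matrix.det (∑ l, ((X : ℝ[X]) ^ d l) • (S l).map C)).support)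
    (he' : e' ∈ (Matrix.det (∑ l, ((X : ℝ[X]) ^ d l) • (S l).map C)).support) :
    ((((Matrix.det (∑ l, ((X : ℝ[X]) ^ d l) • (S l).map C)).support.filter (· < e)).card
        + ((Matrix.det (∑ l, ((X : ℝ[X]) ^ d l) • (S l).map C)).support.filter (· < e')).card) % 2 = 0 →
      0 < (Matrix.det (∑ l, ((X : ℝ[X]) ^ d l) • (S l).map C)).coeff e * (Matrix.det (∑ l, ((X : ℝ[X]) ^ d l) • (S l).map C)).coeff e') ∧
    ((((Matrix.det (∑ l, ((X : ℝ[X]) ^ d l) • (S l).map C)).support.filter (· < e)).card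
        + ((Matrix.det (∑ l, ((X : ℝ[X]) ^ d l) • (S l).map C)).support.filter (· < e')).card) % 2 = 1 →
      (Matrix.det (∑ l, ((X : ℝ[X]) ^ d l) • (S l).map C)).coeff e * (Matrix.det (∑ l, ((X : ℝ[X]) ^ d l) • (S l).map C)).coeff e' < 0) := by
  have key := pow_rank_mul_coeff_mul_coeff_pos_of_sharp _ (sharp_of_nullNull_seventeen d S h0 h3 h17) he he'
  rcases mod_two_of_neg_one_pow_mul_pos key with ⟨p, w⟩ | ⟨p, w⟩
  · exact ⟨fun _ => w, fun h => by omega⟩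
  · exact ⟨fun h => by omega, fun _ => w⟩

/-- **Top slot versus top-window functional (null-null sheet).**  `S₃ ⪰ 0` with kernel vector `k ≠ 0` on a null-null seventeen: for `x ≠ 3`,
`c_{33x} = tr(adj S₃·S_x)` has the sign of `kᵀS_xk`. [folklore] -/
theorem top_slot_mul_dotProduct_mulVec_pos_of_nullNull_seventeen (d : Fin 4 → ℕ) (hd : StrictMono d) (S : Fin 4 → Matrix (Fin 3) (Fin 3) ℝ)
    (hS : ∀ l, (S l).IsSymm) (h0 : (S 0).det = 0) (h3 : (S 3).det = 0) (hpsd : (S 3).PosSemidef) (h17 : 17 ≤ ((Matrix.det (∑ l, ((X : ℝ[X]) ^ d l) • (S l).map C)).roots.toFinset.filter (fun t => 0 < t)).card)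
    {k : Fin 3 → ℝ} (hk : k ≠ 0) (hPk : S 3 *ᵥ k = 0) {x : Fin 4} (hx : x ≠ 3) :
    0 < ((S 3).adjugate * S x).trace * (k ⬝ᵥ S x *ᵥ k) := by
  have hne := trace_adjugate_mul_ne_zero_of_nullNull_seventeen d hd S h0 h3 h17 3 x hx.symm
  have e := dotProduct_self_mul_trace_adjugate_mul (S 3) (S x) (hS 3) hPk
  have hkk : 0 < k ⬝ᵥ k := lt_of_le_of_ne (by
      simp only [dotProduct, Fin.sum_univ_three]
      nlinarith [mul_self_nonneg (k 0), mul_self_nonneg (k 1), mul_self_nonneg (k 2)])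
    (Ne.symm fun h => hk (dotProduct_self_eq_zero.mp h))
  have htr0 : 0 ≤ (S 3).adjugate.trace := (adjugate_posSemidef_of_posSemidef hpsd).trace_nonneg
  have htr : 0 < (S 3).adjugate.trace := by
    refine lt_of_le_of_ne htr0 fun h0' => ?_
    rw [← h0', zero_mul] at e
    exact hne ((mul_eq_zero.mp e).resolve_left hkk.ne')
  have e2 : (S 3).adjugate.trace * (((S 3).adjugate * S x).trace * (k ⬝ᵥ S x *ᵥ k))
      = (k ⬝ᵥ k) * ((S 3).adjugate * S x).trace ^ 2 := by
    rw [pow_two, ← mul_assoc (k ⬝ᵥ k), e]; ring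
  have hsq : 0 < ((S 3).adjugate * S x).trace ^ 2 := by positivity
  have hpos : 0 < (S 3).adjugate.trace * (((S 3).adjugate * S x).trace * (k ⬝ᵥ S x *ᵥ k)) := by
    rw [e2]; exact mul_pos hkk hsq
  exact (pos_iff_pos_of_mul_pos hpos).1 htr

/-- **END-CELL PINNING on a null-null seventeen (`S₃ ⪰ 0`).**  Sorted support, symmetric letters, `det S₀ = det S₃ = 0`, `S₃ ⪰ 0`, `17` roots:
`c_{003} > 0 ∧ c_{033} > 0 ⇒ S₀ ⪰ 0`; `c_{003} > 0 ∧ c_{033} < 0 ⇒ S₀ ⪯ 0`; `c_{003} < 0 ⇒ S₀` is in neither semidefinite cell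
(`c_{003} = tr(adj S₀·S₃)`, `c_{033} = tr(adj S₃·S₀)`). [folklore] -/
theorem endCell_of_nullNull_seventeen (d : Fin 4 → ℕ) (hd : StrictMono d) (S : Fin 4 → Matrix (Fin 3) (Fin 3) ℝ)
    (hS : ∀ l, (S l).IsSymm) (h0 : (S 0).det = 0) (h3 : (S 3).det = 0) (hpsd : (S 3).PosSemidef) (h17 : 17 ≤ ((Matrix.det (∑ l, ((X : ℝ[X]) ^ d l) • (S l).map C)).roots.toFinset.filter (fun t => 0 < t)).card) :
    (0 < ((S 0).adjugate * S 3).trace → 0 < ((S 3).adjugate * S 0).trace → (S 0).PosSemidef)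
    ∧ (0 < ((S 0).adjugate * S 3).trace → ((S 3).adjugate * S 0).trace < 0 → (-S 0).PosSemidef)
    ∧ (((S 0).adjugate * S 3).trace < 0 → ¬ (S 0).PosSemidef ∧ ¬ (-S 0).PosSemidef) := by
  obtain ⟨k, hk, hPk⟩ := Matrix.exists_mulVec_eq_zero_iff.mpr h3
  have rel := top_slot_mul_dotProduct_mulVec_pos_of_nullNull_seventeen d hd S hS h0 h3 hpsd h17 hk hPk (x := 0) (by decide)
  refine ⟨fun hq hT => ?_, fun hq hT => ?_, fun hq => not_semidef_of_trace_adjugate_mul_neg hpsd hq⟩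
  · exact posSemidef_of_sheet_signs hpsd hPk (hS 0) hq h0.symm.le (by nlinarith [rel, hT])
  · exact neg_posSemidef_of_sheet_signs hpsd hPk (hS 0) hq h0.le (by nlinarith [rel, hT])

/-! ## 3. Closures of the doubly-semidefinite cells (orientation-free) and the oriented end test -/

/-- **`S₀ ⪰ 0 ∧ S₃ ⪰ 0` needs `c_{003} > 0 ∧ c_{033} > 0`**: on a sorted support whose two slots `{0,0,3}`, `{0,3,3}` have sheet ranks of DIFFERENT parity the two
coefficients have opposite signs on any seventeen, so a null-null pencil with both end letters positive semidefinite (and singular) has `Z₊ ≤ 16`. [folklore] -/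
theorem card_posRoots_le_16_of_nullNull_psd_psd (d : Fin 4 → ℕ) (hd : StrictMono d) (S : Fin 4 → Matrix (Fin 3) (Fin 3) ℝ)
    (hS : ∀ l, (S l).IsSymm) (h0 : (S 0).det = 0) (h3 : (S 3).det = 0) (hpsd0 : (S 0).PosSemidef) (hpsd3 : (S 3).PosSemidef)
    (ρ : ℕ → ℕ) (hρ : ∀ n, ρ n = ((((((Finset.univ : Finset (Sym (Fin 4) 3)).erase (Sym.replicate 3 3)).erase (Sym.replicate 3 0)).image
          (fun s : Sym (Fin 4) 3 => ((s : Multiset (Fin 4)).map d).sum)).filter (· < n)).card))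
    (hpar : ρ (2 * d 0 + d 3) % 2 ≠ ρ (2 * d 3 + d 0) % 2) : ((Matrix.det (∑ l, ((X : ℝ[X]) ^ d l) • (S l).map C)).roots.toFinset.filter (fun t => 0 < t)).card ≤ 16 := by
  by_contra hlt
  have h17 : 17 ≤ ((Matrix.det (∑ l, ((X : ℝ[X]) ^ d l) • (S l).map C)).roots.toFinset.filter (fun t => 0 < t)).card := by omega
  have hρ' : ∀ n, ρ n = ((Matrix.det (∑ l, ((X : ℝ[X]) ^ d l) • (S l).map C)).support.filter (· < n)).card := fun n => by
    rw [hρ, sheetRank_eq_of_nullNull_seventeen d S h0 h3 h17]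
  obtain ⟨c03, m03⟩ := coeff_square_of_nullNull_seventeen d hd S h0 h3 h17 0 3 (by decide)
  obtain ⟨c30, m30⟩ := coeff_square_of_nullNull_seventeen d hd S h0 h3 h17 3 0 (by decide)
  have r := (coeff_mul_coeff_sign_of_nullNull_seventeen d S h0 h3 h17 m03 m30).2 (by rw [← hρ', ← hρ']; omega)
  rw [c03, c30] at r
  obtain ⟨H1, H2, H3⟩ := endCell_of_nullNull_seventeen d hd S hS h0 h3 hpsd3 h17
  have hne := trace_adjugate_mul_ne_zero_of_nullNull_seventeen d hd S h0 h3 h17 0 3 (by decide)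
  rcases lt_or_gt_of_ne hne with hn | hp
  · exact (H3 hn).1 hpsd0
  · -- `c_{003} > 0`, so `c_{033} < 0`, so `S₀ ⪯ 0` — but `S₀ ⪰ 0` and `S₀ ≠ 0`-ish: contradiction via `kᵀS₀k`
    have hT : ((S 3).adjugate * S 0).trace < 0 := by nlinarith [r, hp]
    have hN := H2 hp hT
    -- `S₀ ⪰ 0` and `−S₀ ⪰ 0` ⇒ `S₀ = 0` ⇒ `adj S₀ = 0` ⇒ `c_{003} = 0`
    open scoped MatrixOrder in
    have hz : S 0 = 0 := le_antisymm (by simpa using hN.nonneg) hpsd0.nonneg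
    rw [hz, Matrix.adjugate_zero, Matrix.zero_mul, Matrix.trace_zero] at hp
    exact lt_irrefl _ hp

/-- **`S₀ ⪰ 0 ∧ S₃ ⪯ 0` needs `c_{003} < 0 ∧ c_{033} > 0`**: if the two slots have sheet ranks of EQUAL parity, `Z₊ ≤ 16`. [folklore] -/
theorem card_posRoots_le_16_of_nullNull_psd_nsd (d : Fin 4 → ℕ) (hd : StrictMono d) (S : Fin 4 → Matrix (Fin 3) (Fin 3) ℝ)
    (hS : ∀ l, (S l).IsSymm) (h0 : (S 0).det = 0) (h3 : (S 3).det = 0) (hpsd0 : (S 0).PosSemidef) (hnsd3 : (-(S 3)).PosSemidef)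
    (ρ : ℕ → ℕ) (hρ : ∀ n, ρ n = ((((((Finset.univ : Finset (Sym (Fin 4) 3)).erase (Sym.replicate 3 3)).erase (Sym.replicate 3 0)).image
          (fun s : Sym (Fin 4) 3 => ((s : Multiset (Fin 4)).map d).sum)).filter (· < n)).card))
    (hpar : ρ (2 * d 0 + d 3) % 2 = ρ (2 * d 3 + d 0) % 2) : ((Matrix.det (∑ l, ((X : ℝ[X]) ^ d l) • (S l).map C)).roots.toFinset.filter (fun t => 0 < t)).card ≤ 16 := by
  by_contra hlt
  have h17 : 17 ≤ ((Matrix.det (∑ l, ((X : ℝ[X]) ^ d l) • (S l).map C)).roots.toFinset.filter (fun t => 0 < t)).card := by omega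
  have hρ' : ∀ n, ρ n = ((Matrix.det (∑ l, ((X : ℝ[X]) ^ d l) • (S l).map C)).support.filter (· < n)).card := fun n => by
    rw [hρ, sheetRank_eq_of_nullNull_seventeen d S h0 h3 h17]
  obtain ⟨c03, m03⟩ := coeff_square_of_nullNull_seventeen d hd S h0 h3 h17 0 3 (by decide)
  obtain ⟨c30, m30⟩ := coeff_square_of_nullNull_seventeen d hd S h0 h3 h17 3 0 (by decide)
  have r := (coeff_mul_coeff_sign_of_nullNull_seventeen d S h0 h3 h17 m03 m30).1 (by rw [← hρ', ← hρ']; omega)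
  rw [c03, c30] at r
  have hdet : ∀ l, ((fun l => -S l) l).det = -(S l).det := fun l => by simp only [Matrix.det_neg, Fintype.card_fin]; norm_num
  have h17' : 17 ≤ ((Matrix.det (∑ l, ((X : ℝ[X]) ^ d l) • ((fun l => -S l) l).map C)).roots.toFinset.filter (fun t => 0 < t)).card := by
    rw [posRoots_pencil_neg_three]; exact h17
  have E := endCell_of_nullNull_seventeen d hd (fun l => -S l) (fun l => (hS l).neg) (by rw [hdet, h0, neg_zero]) (by rw [hdet, h3, neg_zero]) hnsd3 h17'
  have e1 : ((-S 0).adjugate * (-S 3)).trace = -(((S 0).adjugate * S 3).trace) := by rw [adjugate_neg_aux'', Matrix.mul_neg, Matrix.trace_neg]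
  have e2 : ((-S 3).adjugate * (-S 0)).trace = -(((S 3).adjugate * S 0).trace) := by rw [adjugate_neg_aux'', Matrix.mul_neg, Matrix.trace_neg]
  beta_reduce at E
  rw [e1, e2, neg_neg] at E
  obtain ⟨H1, -, H3⟩ := E
  have hne := trace_adjugate_mul_ne_zero_of_nullNull_seventeen d hd S h0 h3 h17 0 3 (by decide)
  rcases lt_or_gt_of_ne hne with hn | hp
  · have hN := H1 (by linarith) (by nlinarith [r, hn])
    open scoped MatrixOrder in
    have hz : S 0 = 0 := le_antisymm (by simpa using hN.nonneg) hpsd0.nonneg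
    rw [hz, Matrix.adjugate_zero, Matrix.zero_mul, Matrix.trace_zero] at hn
    exact lt_irrefl _ hn
  · exact (H3 (by linarith)).2 hpsd0

/-- **`S₀ ⪯ 0 ∧ S₃ ⪯ 0`**, ranks of `{0,0,3}`, `{0,3,3}` of different parity ⇒ `Z₊ ≤ 16` (from `…_psd_psd` by `S ↦ −S`). [folklore] -/
theorem card_posRoots_le_16_of_nullNull_nsd_nsd (d : Fin 4 → ℕ) (hd : StrictMono d) (S : Fin 4 → Matrix (Fin 3) (Fin 3) ℝ)
    (hS : ∀ l, (S l).IsSymm) (h0 : (S 0).det = 0) (h3 : (S 3).det = 0) (hnsd0 : (-(S 0)).PosSemidef) (hnsd3 : (-(S 3)).PosSemidef)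
    (ρ : ℕ → ℕ) (hρ : ∀ n, ρ n = ((((((Finset.univ : Finset (Sym (Fin 4) 3)).erase (Sym.replicate 3 3)).erase (Sym.replicate 3 0)).image
          (fun s : Sym (Fin 4) 3 => ((s : Multiset (Fin 4)).map d).sum)).filter (· < n)).card))
    (hpar : ρ (2 * d 0 + d 3) % 2 ≠ ρ (2 * d 3 + d 0) % 2) : ((Matrix.det (∑ l, ((X : ℝ[X]) ^ d l) • (S l).map C)).roots.toFinset.filter (fun t => 0 < t)).card ≤ 16 := by
  have hdet : ∀ l, ((fun l => -S l) l).det = -(S l).det := fun l => by simp only [Matrix.det_neg, Fintype.card_fin]; norm_num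
  have h := card_posRoots_le_16_of_nullNull_psd_psd d hd (fun l => -S l) (fun l => (hS l).neg) (by rw [hdet, h0, neg_zero])
    (by rw [hdet, h3, neg_zero]) hnsd0 hnsd3 ρ hρ hpar
  rwa [posRoots_pencil_neg_three] at h

/-- **`S₀ ⪯ 0 ∧ S₃ ⪰ 0`**, ranks of `{0,0,3}`, `{0,3,3}` of equal parity ⇒ `Z₊ ≤ 16` (from `…_psd_nsd` by `S ↦ −S`). [folklore] -/
theorem card_posRoots_le_16_of_nullNull_nsd_psd (d : Fin 4 → ℕ) (hd : StrictMono d) (S : Fin 4 → Matrix (Fin 3) (Fin 3) ℝ)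
    (hS : ∀ l, (S l).IsSymm) (h0 : (S 0).det = 0) (h3 : (S 3).det = 0) (hnsd0 : (-(S 0)).PosSemidef) (hpsd3 : (S 3).PosSemidef)
    (ρ : ℕ → ℕ) (hρ : ∀ n, ρ n = ((((((Finset.univ : Finset (Sym (Fin 4) 3)).erase (Sym.replicate 3 3)).erase (Sym.replicate 3 0)).image
          (fun s : Sym (Fin 4) 3 => ((s : Multiset (Fin 4)).map d).sum)).filter (· < n)).card))
    (hpar : ρ (2 * d 0 + d 3) % 2 = ρ (2 * d 3 + d 0) % 2) : ((Matrix.det (∑ l, ((X : ℝ[X]) ^ d l) • (S l).map C)).roots.toFinset.filter (fun t => 0 < t)).card ≤ 16 := by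
  have hdet : ∀ l, ((fun l => -S l) l).det = -(S l).det := fun l => by simp only [Matrix.det_neg, Fintype.card_fin]; norm_num
  have hpsd3' : (-((fun l => -S l) 3)).PosSemidef := by simpa using hpsd3
  have h := card_posRoots_le_16_of_nullNull_psd_nsd d hd (fun l => -S l) (fun l => (hS l).neg) (by rw [hdet, h0, neg_zero])
    (by rw [hdet, h3, neg_zero]) hnsd0 hpsd3' ρ hρ hpar
  rwa [posRoots_pencil_neg_three] at h

/-! ## 4. Instances: the `(0,1,4,N)` rail support of the kernel sixteen (p583093), the census supports `(0,8,14,23)` (null-null fifteen p558265) and `(0,4,9,16)` -/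

/-- The `18` sheet exponents of the null-null sheet on `(0, 1, 4, 100)`. [folklore] -/
theorem nullNullExponents_0_1_4_100 :
    ((((Finset.univ : Finset (Sym (Fin 4) 3)).erase (Sym.replicate 3 3)).erase (Sym.replicate 3 0)).image
        (fun s : Sym (Fin 4) 3 => ((s : Multiset (Fin 4)).map (![0, 1, 4, 100] : Fin 4 → ℕ)).sum))
      = ({1, 2, 3, 4, 5, 6, 8, 9, 12, 100, 101, 102, 104, 105, 108, 200, 201, 204} : Finset ℕ) := by
  decide

/-- **`(0, 1, 4, 100)`: a null-null pencil (`det S₀ = det S₃ = 0`, symmetric letters) with S₀ ⪰ 0 ∧ S₃ ⪯ 0 has `Z₊ ≤ 16`** (the end slots `{0,0,3}`,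
`{0,3,3}` have sheet ranks `9`, `15` of EQUAL parity; `decide`). [folklore] -/
theorem card_posRoots_le_16_of_nullNull_psd_nsd_on_0_1_4_100 (S : Fin 4 → Matrix (Fin 3) (Fin 3) ℝ) (hS : ∀ l, (S l).IsSymm)
    (h0 : (S 0).det = 0) (h3 : (S 3).det = 0) (hpsd0 : (S 0).PosSemidef) (hnsd3 : (-(S 3)).PosSemidef) :
    ((Matrix.det (∑ l, ((X : ℝ[X]) ^ ((![0, 1, 4, 100] : Fin 4 → ℕ) l) • (S l).map C))).roots.toFinset.filter (fun t => 0 < t)).card ≤ 16 := by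
  have hd : StrictMono (![0, 1, 4, 100] : Fin 4 → ℕ) := by
    refine Fin.strictMono_iff_lt_succ.2 fun j => ?_
    fin_cases j <;> decide
  exact card_posRoots_le_16_of_nullNull_psd_nsd _ hd S hS h0 h3 hpsd0 hnsd3 (fun n => ((({1, 2, 3, 4, 5, 6, 8, 9, 12, 100, 101, 102, 104, 105, 108, 200, 201, 204} : Finset ℕ)).filter (· < n)).card) (fun n => by rw [nullNullExponents_0_1_4_100]) (by decide)

/-- **`(0, 1, 4, 100)`: a null-null pencil (`det S₀ = det S₃ = 0`, symmetric letters) with S₀ ⪯ 0 ∧ S₃ ⪰ 0 has `Z₊ ≤ 16`** (the end slots `{0,0,3}`,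
`{0,3,3}` have sheet ranks `9`, `15` of EQUAL parity; `decide`). [folklore] -/
theorem card_posRoots_le_16_of_nullNull_nsd_psd_on_0_1_4_100 (S : Fin 4 → Matrix (Fin 3) (Fin 3) ℝ) (hS : ∀ l, (S l).IsSymm)
    (h0 : (S 0).det = 0) (h3 : (S 3).det = 0) (hnsd0 : (-(S 0)).PosSemidef) (hpsd3 : (S 3).PosSemidef) :
    ((Matrix.det (∑ l, ((X : ℝ[X]) ^ ((![0, 1, 4, 100] : Fin 4 → ℕ) l) • (S l).map C))).roots.toFinset.filter (fun t => 0 < t)).card ≤ 16 := by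
  have hd : StrictMono (![0, 1, 4, 100] : Fin 4 → ℕ) := by
    refine Fin.strictMono_iff_lt_succ.2 fun j => ?_
    fin_cases j <;> decide
  exact card_posRoots_le_16_of_nullNull_nsd_psd _ hd S hS h0 h3 hnsd0 hpsd3 (fun n => ((({1, 2, 3, 4, 5, 6, 8, 9, 12, 100, 101, 102, 104, 105, 108, 200, 201, 204} : Finset ℕ)).filter (· < n)).card) (fun n => by rw [nullNullExponents_0_1_4_100]) (by decide)

/-- The `18` sheet exponents of the null-null sheet on `(0, 8, 14, 23)`. [folklore] -/
theorem nullNullExponents_0_8_14_23 :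
    ((((Finset.univ : Finset (Sym (Fin 4) 3)).erase (Sym.replicate 3 3)).erase (Sym.replicate 3 0)).image
        (fun s : Sym (Fin 4) 3 => ((s : Multiset (Fin 4)).map (![0, 8, 14, 23] : Fin 4 → ℕ)).sum))
      = ({8, 14, 16, 22, 23, 24, 28, 30, 31, 36, 37, 39, 42, 45, 46, 51, 54, 60} : Finset ℕ) := by
  decide

/-- **`(0, 8, 14, 23)`: a null-null pencil (`det S₀ = det S₃ = 0`, symmetric letters) with S₀ ⪰ 0 ∧ S₃ ⪯ 0 has `Z₊ ≤ 16`** (the end slots `{0,0,3}`,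
`{0,3,3}` have sheet ranks `4`, `14` of EQUAL parity; `decide`). [folklore] -/
theorem card_posRoots_le_16_of_nullNull_psd_nsd_on_0_8_14_23 (S : Fin 4 → Matrix (Fin 3) (Fin 3) ℝ) (hS : ∀ l, (S l).IsSymm)
    (h0 : (S 0).det = 0) (h3 : (S 3).det = 0) (hpsd0 : (S 0).PosSemidef) (hnsd3 : (-(S 3)).PosSemidef) :
    ((Matrix.det (∑ l, ((X : ℝ[X]) ^ ((![0, 8, 14, 23] : Fin 4 → ℕ) l) • (S l).map C))).roots.toFinset.filter (fun t => 0 < t)).card ≤ 16 := by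
  have hd : StrictMono (![0, 8, 14, 23] : Fin 4 → ℕ) := by
    refine Fin.strictMono_iff_lt_succ.2 fun j => ?_
    fin_cases j <;> decide
  exact card_posRoots_le_16_of_nullNull_psd_nsd _ hd S hS h0 h3 hpsd0 hnsd3 (fun n => ((({8, 14, 16, 22, 23, 24, 28, 30, 31, 36, 37, 39, 42, 45, 46, 51, 54, 60} : Finset ℕ)).filter (· < n)).card) (fun n => by rw [nullNullExponents_0_8_14_23]) (by decide)

/-- **`(0, 8, 14, 23)`: a null-null pencil (`det S₀ = det S₃ = 0`, symmetric letters) with S₀ ⪯ 0 ∧ S₃ ⪰ 0 has `Z₊ ≤ 16`** (the end slots `{0,0,3}`,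
`{0,3,3}` have sheet ranks `4`, `14` of EQUAL parity; `decide`). [folklore] -/
theorem card_posRoots_le_16_of_nullNull_nsd_psd_on_0_8_14_23 (S : Fin 4 → Matrix (Fin 3) (Fin 3) ℝ) (hS : ∀ l, (S l).IsSymm)
    (h0 : (S 0).det = 0) (h3 : (S 3).det = 0) (hnsd0 : (-(S 0)).PosSemidef) (hpsd3 : (S 3).PosSemidef) :
    ((Matrix.det (∑ l, ((X : ℝ[X]) ^ ((![0, 8, 14, 23] : Fin 4 → ℕ) l) • (S l).map C))).roots.toFinset.filter (fun t => 0 < t)).card ≤ 16 := by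
  have hd : StrictMono (![0, 8, 14, 23] : Fin 4 → ℕ) := by
    refine Fin.strictMono_iff_lt_succ.2 fun j => ?_
    fin_cases j <;> decide
  exact card_posRoots_le_16_of_nullNull_nsd_psd _ hd S hS h0 h3 hnsd0 hpsd3 (fun n => ((({8, 14, 16, 22, 23, 24, 28, 30, 31, 36, 37, 39, 42, 45, 46, 51, 54, 60} : Finset ℕ)).filter (· < n)).card) (fun n => by rw [nullNullExponents_0_8_14_23]) (by decide)

/-- **`(0, 4, 9, 16)`: a null-null pencil (`det S₀ = det S₃ = 0`, symmetric letters) with S₀ ⪰ 0 ∧ S₃ ⪰ 0 has `Z₊ ≤ 16`** (the end slots `{0,0,3}`,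
`{0,3,3}` have sheet ranks `5`, `14` of DIFFERENT parity; `decide`). [folklore] -/
theorem card_posRoots_le_16_of_nullNull_psd_psd_on_0_4_9_16 (S : Fin 4 → Matrix (Fin 3) (Fin 3) ℝ) (hS : ∀ l, (S l).IsSymm)
    (h0 : (S 0).det = 0) (h3 : (S 3).det = 0) (hpsd0 : (S 0).PosSemidef) (hpsd3 : (S 3).PosSemidef) :
    ((Matrix.det (∑ l, ((X : ℝ[X]) ^ ((![0, 4, 9, 16] : Fin 4 → ℕ) l) • (S l).map C))).roots.toFinset.filter (fun t => 0 < t)).card ≤ 16 := by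
  have hd : StrictMono (![0, 4, 9, 16] : Fin 4 → ℕ) := by
    refine Fin.strictMono_iff_lt_succ.2 fun j => ?_
    fin_cases j <;> decide
  exact card_posRoots_le_16_of_nullNull_psd_psd _ hd S hS h0 h3 hpsd0 hpsd3 (fun n => ((({4, 8, 9, 12, 13, 16, 17, 18, 20, 22, 24, 25, 27, 29, 32, 34, 36, 41} : Finset ℕ)).filter (· < n)).card) (fun n => by rw [nullNullExponents_0_4_9_16]) (by decide)

/-- **`(0, 4, 9, 16)`: a null-null pencil (`det S₀ = det S₃ = 0`, symmetric letters) with S₀ ⪯ 0 ∧ S₃ ⪯ 0 has `Z₊ ≤ 16`** (the end slots `{0,0,3}`,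
`{0,3,3}` have sheet ranks `5`, `14` of DIFFERENT parity; `decide`). [folklore] -/
theorem card_posRoots_le_16_of_nullNull_nsd_nsd_on_0_4_9_16 (S : Fin 4 → Matrix (Fin 3) (Fin 3) ℝ) (hS : ∀ l, (S l).IsSymm)
    (h0 : (S 0).det = 0) (h3 : (S 3).det = 0) (hnsd0 : (-(S 0)).PosSemidef) (hnsd3 : (-(S 3)).PosSemidef) :
    ((Matrix.det (∑ l, ((X : ℝ[X]) ^ ((![0, 4, 9, 16] : Fin 4 → ℕ) l) • (S l).map C))).roots.toFinset.filter (fun t => 0 < t)).card ≤ 16 := by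
  have hd : StrictMono (![0, 4, 9, 16] : Fin 4 → ℕ) := by
    refine Fin.strictMono_iff_lt_succ.2 fun j => ?_
    fin_cases j <;> decide
  exact card_posRoots_le_16_of_nullNull_nsd_nsd _ hd S hS h0 h3 hnsd0 hnsd3 (fun n => ((({4, 8, 9, 12, 13, 16, 17, 18, 20, 22, 24, 25, 27, 29, 32, 34, 36, 41} : Finset ℕ)).filter (· < n)).card) (fun n => by rw [nullNullExponents_0_4_9_16]) (by decide)

end Summit.ValiantsHypothesis.ValiantsHypothesis.Theorems.LacunarySymmetroidMatrixDescartes.Census
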